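import Summits.QuantumAdvantage.AdviceFreeQNC0.RingFlipMap
import HarnessLib

/-!
# Cell qa-qnc0 — planner qa-qnc0-p2's walk coordinates: `SuppWalkLaw` and the trace form, all `N`

Planner qa-qnc0-p2 (ROUND-1 §9.10, `RingFrameSketch.lean`; both registered lines `product` /
`tensor` of the route crux `RingToElim`, stub `stub_transport`) rewrites the ring game on the
transposition class (`#zeros(x)` odd) in WALK COORDINATES: `u_i(x) = ⊕_{j ≤ i} ¬x_j`,
`W_k(x) = #{i < k : u_i = 1}`, `W = W_{N-1}`; the conjectured-for-all-`N` (checked `N ≤ 12`,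
kernel `N = 7`) **support law** `v⋆_k = [k + N + W_k + W ≢ 2 (mod 3)]` for the non-zero kernel
vector, and the **trace form** `Rel x z ↔ Σ_k ỹ_k g_k ≡ 1 (mod 2)`.

This file PROVES both for every `N ≥ 3`, from the structure theorem of `RingKernel.lean`:

* `walkSt` — the dictionary `(X mod 3, previous prefix parity) ↦` transfer-map state, and the
  one-step law `tstep_walkSt` (12-case check); `iter_walkSt` — along ANY word the trajectory
  started at `walkSt c false` is `walkSt (c + k + W_k) (parity of zeros before k)`;
* `suppWalkLaw` — p2's `SuppWalkLaw` for all `N ≥ 3` (hypothesis: an odd number of zeros);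
* `traceForm` — `Rel x z ↔ #{k : (z ⊕ t(x))_k ∧ k + N + W_k + W ≢ 2 (3)}` odd, with the canonical
  guess `t_j = x_j ⊕ x_{j+1}` of `RingCanonical.lean` as reference strategy (p2 uses
  `zSixth ⊕ e₀ ⊕ e₁`; any strategy valid on the class serves).

* `card_even_class_le` — at most `2ⁿ` of the `2ⁿ⁺¹` patterns have an even number of zeros.

So the walk-coordinate form of the ring game used by the crux lines is a THEOREM for all `N`;
`WalkTransport.lean` turns it into `RingHardU → RingHard 2` (`stub_transport`).
-/

namespace Summit.QuantumAdvantage.AdviceFreeQNC0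

open Finset Literature.Computability.QuantumComplexity Literature.Computability.QuantumComplexity.RingHLF

variable {N : ℕ}

/-! ### p2's coordinates (verbatim) -/

/-- `u`-coordinate `u_i(x) = ⊕_{j ≤ i} ¬ x_j` (planner qa-qnc0-p2, verbatim). -/
def uCoord (x : Fin N → Bool) (i : Fin N) : Bool :=
  decide ((univ.filter fun j : Fin N => j ≤ i ∧ x j = false).card % 2 = 1)

/-- Prefix weights `W_k(x) = #{i < k : u_i(x) = 1}` (planner qa-qnc0-p2, verbatim);
`W = Wk x (N - 1)`. -/
def Wk (x : Fin N → Bool) (k : ℕ) : ℕ := (univ.filter fun i : Fin N => i.val < k ∧ uCoord x i = true).card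

/-- The parity of the number of zeros among `x_0 … x_{k-1}` (`= u_{k-1}` for `k ≥ 1`, `false` for
`k = 0`). -/
def zpar (x : Fin N → Bool) (k : ℕ) : Bool :=
  decide ((univ.filter fun j : Fin N => j.val < k ∧ x j = false).card % 2 = 1)

/-! ### Prefix bookkeeping -/

/-- Splitting off the last index of a prefix count. -/
private theorem card_filter_lt_succ (p : Fin N → Prop) [DecidablePred p] {k : ℕ} (hk : k < N) :
    (univ.filter fun j : Fin N => j.val < k + 1 ∧ p j).card =
      (univ.filter fun j : Fin N => j.val < k ∧ p j).card + (if p ⟨k, hk⟩ then 1 else 0) := by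
  have hsplit : (univ.filter fun j : Fin N => j.val < k + 1 ∧ p j) =
      (univ.filter fun j : Fin N => j.val < k ∧ p j) ∪
        (univ.filter fun j : Fin N => j = ⟨k, hk⟩ ∧ p j) := by
    ext j
    simp only [mem_filter, mem_univ, true_and, mem_union]
    constructor
    · rintro ⟨hj, hp⟩
      by_cases h : j.val < k
      · exact Or.inl ⟨h, hp⟩
      · exact Or.inr ⟨Fin.ext (by simp; omega), hp⟩
    · rintro (⟨hj, hp⟩ | ⟨rfl, hp⟩)
      · exact ⟨by omega, hp⟩
      · exact ⟨by simp, hp⟩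
  rw [hsplit, card_union_of_disjoint]
  · congr 1
    by_cases hp : p ⟨k, hk⟩
    · rw [if_pos hp]
      have : (univ.filter fun j : Fin N => j = ⟨k, hk⟩ ∧ p j) = {⟨k, hk⟩} := by
        ext j
        simp only [mem_filter, mem_univ, true_and, mem_singleton]
        exact ⟨fun h => h.1, fun h => ⟨h, h ▸ hp⟩⟩
      rw [this, card_singleton]
    · rw [if_neg hp]
      have : (univ.filter fun j : Fin N => j = ⟨k, hk⟩ ∧ p j) = ∅ := by
        ext j
        simp only [mem_filter, mem_univ, true_and, Finset.notMem_empty, iff_false, not_and]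
        rintro rfl; exact hp
      rw [this, card_empty]
  · rw [Finset.disjoint_filter]
    rintro j _ ⟨hj, _⟩ ⟨rfl, _⟩
    simp at hj

/-- `u_i = zpar (i+1)`. -/
theorem uCoord_eq_zpar (x : Fin N → Bool) (i : Fin N) : uCoord x i = zpar x (i.val + 1) := by
  unfold uCoord zpar
  have : (univ.filter fun j : Fin N => j ≤ i ∧ x j = false) =
      univ.filter fun j : Fin N => j.val < i.val + 1 ∧ x j = false := by
    ext j
    simp only [mem_filter, mem_univ, true_and, Fin.le_def]
    constructor
    · rintro ⟨h, hx⟩; exact ⟨by omega, hx⟩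
    · rintro ⟨h, hx⟩; exact ⟨by omega, hx⟩
  rw [this]

/-- `zpar 0 = false`. -/
theorem zpar_zero (x : Fin N → Bool) : zpar x 0 = false := by
  unfold zpar
  have : (univ.filter fun j : Fin N => j.val < 0 ∧ x j = false) = ∅ := by
    ext j; simp
  rw [this, card_empty]
  rfl

/-- `zpar (k+1) = zpar k ⊕ ¬x_k`. -/
theorem zpar_succ (x : Fin N → Bool) {k : ℕ} (hk : k < N) :
    zpar x (k + 1) = xor (zpar x k) (!x ⟨k, hk⟩) := by
  unfold zpar
  rw [card_filter_lt_succ (fun j => x j = false) hk]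
  set c := (univ.filter fun j : Fin N => j.val < k ∧ x j = false).card
  cases hx : x ⟨k, hk⟩
  · simp only [if_true, Bool.not_false, Bool.xor_true]
    rcases Nat.mod_two_eq_zero_or_one c with h | h
    · have h1 : (c + 1) % 2 = 1 := by omega
      simp [h, h1]
    · have h1 : (c + 1) % 2 = 0 := by omega
      simp [h, h1]
  · simp

/-- `W_0 = 0`. -/
theorem Wk_zero (x : Fin N → Bool) : Wk x 0 = 0 := by
  unfold Wk
  have : (univ.filter fun i : Fin N => i.val < 0 ∧ uCoord x i = true) = ∅ := by
    ext j; simp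
  rw [this, card_empty]

/-- `W_{k+1} = W_k + [u_k]`. -/
theorem Wk_succ (x : Fin N → Bool) {k : ℕ} (hk : k < N) :
    Wk x (k + 1) = Wk x k + (if uCoord x ⟨k, hk⟩ = true then 1 else 0) := by
  unfold Wk
  exact card_filter_lt_succ (fun i => uCoord x i = true) hk

/-! ### The walk dictionary -/

/-- The dictionary `(X mod 3, previous prefix parity u) ↦` transfer-map state:
`X ≡ 2 ↦ (1,0)`; `X ≡ 0 ↦ (u, 1)`; `X ≡ 1 ↦ (¬u, 1)`. -/
def walkSt (X : ℕ) (u : Bool) : St :=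
  if X % 3 = 2 then (true, false) else (xor u (decide (X % 3 = 1)), true)

/-- `walkSt` is never the zero state. -/
theorem walkSt_ne_zero (X : ℕ) (u : Bool) : walkSt X u ≠ (false, false) := by
  unfold walkSt
  split_ifs <;> simp

/-- The second coordinate of `walkSt X u` is `[X ≢ 2 (mod 3)]`. -/
theorem walkSt_snd (X : ℕ) (u : Bool) : (walkSt X u).2 = decide (X % 3 ≠ 2) := by
  unfold walkSt
  by_cases h : X % 3 = 2 <;> simp [h]

/-- **One-step law**: reading letter `b` moves `walkSt X u` to `walkSt (X + 1 + [u']) u'` with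
`u' = u ⊕ ¬b` (the new prefix parity). A 12-case check modulo `3`. -/
theorem tstep_walkSt (b : Bool) (X : ℕ) (u : Bool) :
    tstep b (walkSt X u) =
      walkSt (X + 1 + (if xor u (!b) = true then 1 else 0)) (xor u (!b)) := by
  have key : ∀ (r : ℕ), r < 3 → ∀ (b u : Bool),
      tstep b (if r = 2 then (true, false) else (xor u (decide (r = 1)), true)) =
        (if (r + 1 + (if xor u (!b) = true then 1 else 0)) % 3 = 2 then (true, false)
         else (xor (xor u (!b)) (decide ((r + 1 + (if xor u (!b) = true then 1 else 0)) % 3 = 1)),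
           true)) := by
    decide
  have hX : X % 3 < 3 := Nat.mod_lt _ (by norm_num)
  unfold walkSt
  rw [key (X % 3) hX b u]
  have hmod : (X + 1 + (if xor u (!b) = true then 1 else 0)) % 3 =
      (X % 3 + 1 + (if xor u (!b) = true then 1 else 0)) % 3 := by
    split_ifs <;> omega
  rw [hmod]

/-- **The trajectory in walk coordinates** (any word, any phase `c`): started at `walkSt c false`,
after `k ≤ N` letters the state is `walkSt (c + k + W_k) (zpar k)`. -/
theorem iter_walkSt (x : Fin N → Bool) (c : ℕ) :
    ∀ k, k ≤ N → iter x k (walkSt c false) = walkSt (c + k + Wk x k) (zpar x k) := by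
  intro k
  induction k with
  | zero => intro _; rw [iter_zero, Wk_zero, zpar_zero]; rfl
  | succ k ih =>
    intro hk
    have hk' : k < N := by omega
    rw [iter_succ x hk', ih (by omega), tstep_walkSt, Wk_succ x hk', zpar_succ x hk',
      uCoord_eq_zpar, zpar_succ x hk']
    congr 1
    split_ifs <;> omega

/-! ### The support law -/

/-- On the transposition class (`#zeros` odd) the whole-word parity is `1`. -/
theorem zpar_length_of_odd (x : Fin N → Bool)
    (hodd : (univ.filter fun j : Fin N => x j = false).card % 2 = 1) : zpar x N = true := by
  unfold zpar
  have : (univ.filter fun j : Fin N => j.val < N ∧ x j = false) =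
      univ.filter fun j : Fin N => x j = false := by
    ext j; simp
  rw [this]
  simpa using hodd

/-- **The fixed state in walk coordinates**: with phase `c = N + W`, the state `walkSt c false` is
fixed by the monodromy of a word with an odd number of zeros. -/
theorem monodromy_walkSt (hN : 1 ≤ N) (x : Fin N → Bool)
    (hodd : (univ.filter fun j : Fin N => x j = false).card % 2 = 1) :
    monodromy (List.ofFn x) (walkSt (N + Wk x (N - 1)) false) = walkSt (N + Wk x (N - 1)) false := by
  rw [← iter_length, iter_walkSt x _ N le_rfl, zpar_length_of_odd x hodd]
  have hW : Wk x N = Wk x (N - 1) + 1 := by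
    have h := Wk_succ x (show N - 1 < N by omega)
    rw [show N - 1 + 1 = N by omega] at h
    rw [h, uCoord_eq_zpar, show N - 1 + 1 = N by omega, zpar_length_of_odd x hodd]
    simp
  rw [hW]
  -- compare the two states modulo 3
  have key : ∀ r : ℕ, r < 3 →
      (if (r + r + 1) % 3 = 2 then ((true, false) : St)
        else (xor true (decide ((r + r + 1) % 3 = 1)), true)) =
      (if r = 2 then (true, false) else (xor false (decide (r = 1)), true)) := by
    decide
  unfold walkSt
  set W := Wk x (N - 1)
  have h3 : (N + W) % 3 < 3 := Nat.mod_lt _ (by norm_num)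
  have hmod : (N + W + N + (W + 1)) % 3 = ((N + W) % 3 + (N + W) % 3 + 1) % 3 := by omega
  rw [hmod, key _ h3]

/-- **p2's `SuppWalkLaw`, all `N ≥ 3`**: on the transposition class (an odd number of zeros) the
non-zero kernel vector is `v_k = [k + N + W_k + W ≢ 2 (mod 3)]`, `W = W_{N-1}`. -/
theorem suppWalkLaw (hN : 3 ≤ N) (x : Fin N → Bool)
    (hodd : (univ.filter fun j : Fin N => x j = false).card % 2 = 1)
    (v : Fin N → Bool) (hv : InKernel x v) (hv0 : v ≠ fun _ => false) (k : Fin N) :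
    v k = decide ((k.val + N + Wk x k.val + Wk x (N - 1)) % 3 ≠ 2) := by
  have hrb : reflBit (List.ofFn x) = true := by
    rw [reflBit_ofFn_iff, Nat.odd_iff]; exact hodd
  set s₀ := walkSt (N + Wk x (N - 1)) false with hs₀
  have hfix := monodromy_walkSt (by omega) x hodd
  -- both `v` and `kernelVec x s₀` are the non-zero kernel vector
  have hk₀ : InKernel x (kernelVec x s₀) := (inKernel_iff_fixed hN x _).2 ⟨s₀, hfix, rfl⟩
  have hne : kernelVec x s₀ ≠ fun _ => false := kernelVec_ne_zero hN x hfix (walkSt_ne_zero _ _)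
  have h1 := ((kernel_odd hN x hrb v).1 hv).resolve_left hv0
  have h2 := ((kernel_odd hN x hrb _).1 hk₀).resolve_left hne
  rw [h1, ← h2]
  show (iter x k.val s₀).2 = _
  rw [hs₀, iter_walkSt x _ k.val k.isLt.le, walkSt_snd]
  congr 2
  omega

/-! ### The trace form -/

/-- **p2's trace form of the ring game, all `N ≥ 3`**: on the transposition class,
`Rel x z ↔ #{k : (z ⊕ t(x))_k = 1 ∧ k + N + W_k + W ≢ 2 (mod 3)}` is odd, where
`t_j = x_j ⊕ x_{j+1}` is the canonical guess (`rel_iff_odd_stake` + `suppWalkLaw`). -/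
theorem traceForm (hN : 3 ≤ N) (x : Fin N → Bool)
    (hodd : (univ.filter fun j : Fin N => x j = false).card % 2 = 1) (z : Fin N → Bool) :
    Rel x z ↔
      (univ.filter fun k : Fin N => xor (z k) (tGuess x k) = true ∧
        (k.val + N + Wk x k.val + Wk x (N - 1)) % 3 ≠ 2).card % 2 = 1 := by
  have hrb : reflBit (List.ofFn x) = true := by
    rw [reflBit_ofFn_iff, Nat.odd_iff]; exact hodd
  rw [rel_iff_odd_stake hN x hrb z]
  unfold dot2
  have hv : InKernel x (kernelVec x (fixVec (sigmaSum (List.ofFn x)))) :=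
    (kernel_odd hN x hrb _).2 (Or.inr rfl)
  have hv0 : kernelVec x (fixVec (sigmaSum (List.ofFn x))) ≠ fun _ => false := by
    refine kernelVec_ne_zero hN x ?_ ?_
    · rw [monodromy_eq_dict, hrb, dict_true_fixed_iff]; exact Or.inr rfl
    · have h3 : ∀ S : ZMod 3, fixVec S ≠ (false, false) := by decide
      exact h3 _
  have hset : (univ.filter fun b : Fin N =>
        kernelVec x (fixVec (sigmaSum (List.ofFn x))) b = true ∧ xor (z b) (tGuess x b) = true) =
      univ.filter fun k : Fin N => xor (z k) (tGuess x k) = true ∧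
        (k.val + N + Wk x k.val + Wk x (N - 1)) % 3 ≠ 2 := by
    ext k
    simp only [mem_filter, mem_univ, true_and, suppWalkLaw hN x hodd _ hv hv0 k,
      decide_eq_true_eq]
    exact and_comm
  rw [hset]

/-! ### The even class (used by `WalkTransport.lean`) -/

variable {n : ℕ}


/-- Flipping bit `0` changes the number of zeros by one. -/
private theorem card_zeros_update (x : Fin (n + 1) → Bool) :
    (univ.filter fun j : Fin (n + 1) => Function.update x 0 (!x 0) j = false).card % 2 =
      ((univ.filter fun j : Fin (n + 1) => x j = false).card + 1) % 2 := by
  have hsplit : ∀ y : Fin (n + 1) → Bool,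
      (univ.filter fun j : Fin (n + 1) => y j = false).card =
        ((univ.filter fun j : Fin (n + 1) => y j = false).erase 0).card +
          (if y 0 = false then 1 else 0) := by
    intro y
    by_cases hy : y 0 = false
    · rw [if_pos hy, Finset.card_erase_add_one]
      simpa using hy
    · rw [if_neg hy, add_zero, Finset.erase_eq_of_notMem]
      simpa using hy
  have hrest : ((univ.filter fun j : Fin (n + 1) => Function.update x 0 (!x 0) j = false).erase 0) =
      (univ.filter fun j : Fin (n + 1) => x j = false).erase 0 := by
    ext j
    simp only [mem_erase, mem_filter, mem_univ, true_and]
    constructor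
    · rintro ⟨hj, h⟩; rw [Function.update_of_ne hj] at h; exact ⟨hj, h⟩
    · rintro ⟨hj, h⟩; rw [Function.update_of_ne hj]; exact ⟨hj, h⟩
  rw [hsplit (Function.update x 0 (!x 0)), hrest, hsplit x, Function.update_self]
  cases x 0
  · simp; omega
  · simp

/-- **At most half the patterns have an even number of zeros** (flipping bit `0` injects the even
class into the odd class). -/
theorem card_even_class_le :
    (univ.filter fun x : Fin (n + 1) → Bool =>
      ¬ (univ.filter fun j : Fin (n + 1) => x j = false).card % 2 = 1).card ≤ 2 ^ n := by
  set E := univ.filter fun x : Fin (n + 1) → Bool =>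
      ¬ (univ.filter fun j : Fin (n + 1) => x j = false).card % 2 = 1 with hE
  set O := univ.filter fun x : Fin (n + 1) → Bool =>
      (univ.filter fun j : Fin (n + 1) => x j = false).card % 2 = 1 with hO
  have hEO : E.card ≤ O.card := by
    refine Finset.card_le_card_of_injOn (fun x => Function.update x 0 (!x 0)) ?_ ?_
    · intro x hx
      rw [hE, Finset.mem_coe, mem_filter] at hx
      rw [hO, Finset.mem_coe, mem_filter]
      refine ⟨mem_univ _, ?_⟩
      rw [card_zeros_update]
      omega
    · intro x₁ _ x₂ _ h
      have h' : ∀ x : Fin (n + 1) → Bool,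
          Function.update (Function.update x 0 (!x 0)) 0 (!(Function.update x 0 (!x 0)) 0) = x := by
        intro x
        funext j
        by_cases hj : j = 0
        · subst hj; simp
        · simp [Function.update_of_ne hj]
      have := congrArg (fun x : Fin (n + 1) → Bool => Function.update x 0 (!x 0)) h
      simp only at this
      rwa [h' x₁, h' x₂] at this
  have htot : O.card + E.card = 2 ^ (n + 1) := by
    rw [hO, hE, Finset.card_filter_add_card_filter_not, card_univ, Fintype.card_fun,
      Fintype.card_bool, Fintype.card_fin]
  have : 2 ^ (n + 1) = 2 * 2 ^ n := by ring
  omega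

end Summit.QuantumAdvantage.AdviceFreeQNC0
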